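import Mathlib
import Summits.Ventures.PercRepro2.Defs
import Summits.Ventures.PercRepro2.Independence
import Summits.Ventures.PercRepro2.Harris
import Summits.Ventures.PercRepro2.Graph
import Summits.Ventures.PercRepro2.Exploration
import Summits.Ventures.PercRepro2.Events
import Summits.Ventures.PercRepro2.FourFunctions
import Summits.Ventures.PercRepro2.Induced
import Summits.Ventures.PercRepro2.Frontier
import Summits.Ventures.PercRepro2.ObsIndependence
import Summits.Ventures.PercRepro2.BHK
import Summits.Ventures.PercRepro2.BHKEvents
import Summits.Ventures.PercRepro2.CaseOneRegime
import Summits.Ventures.PercRepro2.CaseOnePos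
import Summits.Ventures.PercRepro2.CaseOneJ11

/-!
# The cross term (J1) as a Prop: `(J1) = (J1₁) + (J1₂)` (blind cell PercRepro2, p1 g13; lead g22
CONJECTURES row 2′J1, tri/README «(J1₁) — THE ONE-SIDED (J1) AT TABLE LEVEL» 22:37Z: «(J1) =
Cov_μ(σ_b, H₁) + Cov_μ(σ_b, H₂) (exact identity)»)

**(J1)**: `γ · Cov_μ(σ_b, σ₃) ≥ Cov_μ(σ_b, X)`, `σ_v = 1[v ∈ C₁] − 1[v ∈ C₂]`,
`X = 1[a₃ ∈ C₁, o ∈ C₂] − 1[a₃ ∈ C₂, o ∈ C₁]`, `μ = P(· ∣ Q)`, `γ = D_o / D`. Cleared by `D · P(Q)²`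
(**`jOneExpr`**, **`JOne := 0 ≤ jOneExpr`**, a definition only — the simplest non-table statement of
the (HCOV) line, two codes on > 24 M instances, the unit of work since 2026-08-24 20:27Z), it is the
SUM, by definition, of the cleared `(J1₁)` of `CaseOneJ11.lean` (`jOneOneExpr`) and of its
`a₁ ↔ a₂` mirror `(J1₂)` (`jOneOneExpr` with the roots swapped; `Q`, `D`, `D_o` are symmetric and
`σ_b` changes sign — `Dpd_swap`, `Dpdo_swap`, `sigmaB_swap`, `covExpr_swap`, `covExprC_swap`), and
**`jOneExpr_eq_sigma`** writes it in the lead's form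
`D_o · covExprC σ₃ − D · covExprC X`. Hence **`jOne_of_jOneOne_of_mirror`**: `(J1₁) ∧ (J1₂) ⟹ (J1)`,
and the kernel chain regime ⟹ PC1 ⟹ (J1₁) (+ mirror) ⟹ (J1). Definitions and identities only. -/

namespace Summit.Ventures.PercRepro2

namespace CaseOne

section Swap
variable {V : Type*} {E : Type*} [Fintype E] [DecidableEq E] {R : Type*} [CommRing R]

/-- `D` is symmetric in the roots. -/
lemma Dpd_swap (p : E → R) (ends : E → Sym2 V) (a₁ a₂ a₃ : V) :
    Dpd p ends a₂ a₁ a₃ = Dpd p ends a₁ a₂ a₃ := by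
  unfold Dpd
  congr 1
  rw [connEvent_comm ends a₂ a₁]
  ext ω
  simp only [Set.mem_inter_iff]
  tauto

/-- `D_o` is symmetric in the roots. -/
lemma Dpdo_swap (p : E → R) (ends : E → Sym2 V) (o a₁ a₂ a₃ : V) :
    Dpdo p ends o a₂ a₁ a₃ = Dpdo p ends o a₁ a₂ a₃ := by
  unfold Dpdo
  congr 1
  rw [connEvent_comm ends a₂ a₁]
  ext ω
  simp only [Set.mem_inter_iff, Set.mem_union]
  tauto

omit [Fintype E] [DecidableEq E] in
/-- `σ_b` changes sign under the root swap. -/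
lemma sigmaB_swap (ends : E → Sym2 V) (a₁ a₂ b : V) (ω : Config E) :
    sigmaB (R := R) ends a₂ a₁ b ω = -sigmaB ends a₁ a₂ b ω := by
  unfold sigmaB
  ring

/-- `covExprC` with the roots swapped is minus `covExprC`. -/
lemma covExprC_swap (p : E → R) (ends : E → Sym2 V) (a₁ a₂ b : V) (G : Config E → R) :
    covExprC p ends a₂ a₁ b G = -covExprC p ends a₁ a₂ b G := by
  unfold covExprC
  rw [connEvent_comm ends a₂ a₁]
  have e1 : expect p (fun ω => sigmaB ends a₂ a₁ b ω * G ω * ((connEvent ends a₁ a₂)ᶜ).indicator 1 ω) =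
      -expect p (fun ω => sigmaB ends a₁ a₂ b ω * G ω * ((connEvent ends a₁ a₂)ᶜ).indicator 1 ω) := by
    rw [← neg_one_mul, ← expect_const_mul]
    congr 1
    funext ω
    rw [sigmaB_swap]
    ring
  have e2 : expect p (fun ω => sigmaB ends a₂ a₁ b ω * ((connEvent ends a₁ a₂)ᶜ).indicator 1 ω) =
      -expect p (fun ω => sigmaB ends a₁ a₂ b ω * ((connEvent ends a₁ a₂)ᶜ).indicator 1 ω) := by
    rw [← neg_one_mul, ← expect_const_mul]
    congr 1
    funext ω
    rw [sigmaB_swap]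
    ring
  rw [e1, e2]
  ring

/-- `covExpr` with the roots swapped is minus `covExprC` of the functional of `C₂`. -/
lemma covExpr_swap (p : E → R) (ends : E → Sym2 V) (a₁ a₂ b : V) (F : Set V → R) :
    covExpr p ends a₂ a₁ b F = -covExprC p ends a₁ a₂ b (fun ω => F (cluster ends ω a₂)) := by
  rw [covExpr_eq_covExprC, covExprC_swap]

/-- `covExprC` is linear: differences. -/
lemma covExprC_sub (p : E → R) (ends : E → Sym2 V) (a₁ a₂ b : V) (G H : Config E → R) :
    covExprC p ends a₁ a₂ b (fun ω => G ω - H ω) =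
      covExprC p ends a₁ a₂ b G - covExprC p ends a₁ a₂ b H := by
  unfold covExprC
  have e1 : expect p (fun ω => sigmaB ends a₁ a₂ b ω * (G ω - H ω) *
      ((connEvent ends a₁ a₂)ᶜ).indicator 1 ω) =
      expect p (fun ω => sigmaB ends a₁ a₂ b ω * G ω * ((connEvent ends a₁ a₂)ᶜ).indicator 1 ω) -
        expect p (fun ω => sigmaB ends a₁ a₂ b ω * H ω * ((connEvent ends a₁ a₂)ᶜ).indicator 1 ω) := by
    rw [← expect_sub]; congr 1; funext ω; simp only [Pi.sub_apply]; ring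
  have e2 : expect p (fun ω => (G ω - H ω) * ((connEvent ends a₁ a₂)ᶜ).indicator 1 ω) =
      expect p (fun ω => G ω * ((connEvent ends a₁ a₂)ᶜ).indicator 1 ω) -
        expect p (fun ω => H ω * ((connEvent ends a₁ a₂)ᶜ).indicator 1 ω) := by
    rw [← expect_sub]; congr 1; funext ω; simp only [Pi.sub_apply]; ring
  rw [e1, e2]
  ring

end Swap

section J1
variable {V : Type*} {E : Type*} [Fintype E] [DecidableEq E] {R : Type*} [CommRing R]

/-- The cleared `(J1₁)` as a number: `D_o · covExpr 1[a₃ ∈ ·] − D · covExprC (1[a₃ ∈ C₁] 1[o ∈ C₂])`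
(`JOneOne ⟺ 0 ≤ jOneOneExpr`). -/
noncomputable def jOneOneExpr (p : E → R) (ends : E → Sym2 V) (o a₁ a₂ a₃ b : V) : R :=
  Dpdo p ends o a₁ a₂ a₃ * covExpr p ends a₁ a₂ b (({W' : Set V | a₃ ∈ W'}).indicator 1) -
    Dpd p ends a₁ a₂ a₃ * covExprC p ends a₁ a₂ b
      (fun ω => ({W' : Set V | a₃ ∈ W'}).indicator 1 (cluster ends ω a₁) *
        ({S : Set V | o ∈ S}).indicator 1 (cluster ends ω a₂))

/-- **The cleared cross term `(J1)`**: `jOneOneExpr` plus its `a₁ ↔ a₂` mirror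
(`= D P(Q)² [γ Cov_μ(σ_b, σ₃) − Cov_μ(σ_b, X)]`, `jOneExpr_eq_sigma`). -/
noncomputable def jOneExpr (p : E → R) (ends : E → Sym2 V) (o a₁ a₂ a₃ b : V) : R :=
  jOneOneExpr p ends o a₁ a₂ a₃ b + jOneOneExpr p ends o a₂ a₁ a₃ b

/-- `σ₃ = 1[a₃ ∈ C₁] − 1[a₃ ∈ C₂]` as a function of the configuration. -/
noncomputable def sigma3 (ends : E → Sym2 V) (a₁ a₂ a₃ : V) (ω : Config E) : R :=
  ({W' : Set V | a₃ ∈ W'}).indicator 1 (cluster ends ω a₁) -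
    ({W' : Set V | a₃ ∈ W'}).indicator 1 (cluster ends ω a₂)

/-- `X = 1[a₃ ∈ C₁, o ∈ C₂] − 1[a₃ ∈ C₂, o ∈ C₁]`. -/
noncomputable def crossX (ends : E → Sym2 V) (o a₁ a₂ a₃ : V) (ω : Config E) : R :=
  ({W' : Set V | a₃ ∈ W'}).indicator 1 (cluster ends ω a₁) *
      ({S : Set V | o ∈ S}).indicator 1 (cluster ends ω a₂) -
    ({W' : Set V | a₃ ∈ W'}).indicator 1 (cluster ends ω a₂) *
      ({S : Set V | o ∈ S}).indicator 1 (cluster ends ω a₁)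

/-- **`(J1)` in the lead's form**: `jOneExpr = D_o · covExprC σ₃ − D · covExprC X`. -/
theorem jOneExpr_eq_sigma (p : E → R) (ends : E → Sym2 V) (o a₁ a₂ a₃ b : V) :
    jOneExpr p ends o a₁ a₂ a₃ b =
      Dpdo p ends o a₁ a₂ a₃ * covExprC p ends a₁ a₂ b (sigma3 ends a₁ a₂ a₃) -
        Dpd p ends a₁ a₂ a₃ * covExprC p ends a₁ a₂ b (crossX ends o a₁ a₂ a₃) := by
  unfold jOneExpr jOneOneExpr
  rw [Dpd_swap p ends a₁ a₂ a₃, Dpdo_swap p ends o a₁ a₂ a₃, covExpr_swap p ends a₁ a₂ b,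
    covExprC_swap p ends a₁ a₂ b, covExpr_eq_covExprC]
  unfold sigma3 crossX
  rw [covExprC_sub, covExprC_sub]
  ring

end J1

section J1Prop
variable {V : Type*} {E : Type*} [Fintype E] [DecidableEq E] {R : Type*} [CommRing R] [LinearOrder R]

/-- **(J1), the cross term of (HCOV)** (CONJECTURES row 2′J1): `0 ≤ jOneExpr`, i.e.
`γ · Cov_μ(σ_b, σ₃) ≥ Cov_μ(σ_b, X)` cleared by `D · P(Q)²`. A definition only (CANDIDATE, two codes,
0 failures on > 24 M instances; beyond the table — NEG-114). -/
def JOne (p : E → R) (ends : E → Sym2 V) (o a₁ a₂ a₃ b : V) : Prop :=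
  0 ≤ jOneExpr p ends o a₁ a₂ a₃ b

end J1Prop

section J1Chain
variable {V : Type*} {E : Type*} [Fintype E] [DecidableEq E] {R : Type*} [CommRing R] [LinearOrder R]
  [IsStrictOrderedRing R]

/-- `JOneOne ⟺ 0 ≤ jOneOneExpr`. -/
lemma jOneOne_iff (p : E → R) (ends : E → Sym2 V) (o a₁ a₂ a₃ b : V) :
    JOneOne p ends o a₁ a₂ a₃ b ↔ 0 ≤ jOneOneExpr p ends o a₁ a₂ a₃ b := by
  unfold JOneOne jOneOneExpr
  exact (sub_nonneg).symm

/-- **`(J1₁) ∧ (J1₂) ⟹ (J1)`**: the one-sided statement and its root-swapped mirror add up to the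
cross term. -/
theorem jOne_of_jOneOne_of_mirror (p : E → R) (ends : E → Sym2 V) (o a₁ a₂ a₃ b : V)
    (h₁ : JOneOne p ends o a₁ a₂ a₃ b) (h₂ : JOneOne p ends o a₂ a₁ a₃ b) :
    JOne p ends o a₁ a₂ a₃ b := by
  rw [jOneOne_iff] at h₁ h₂
  unfold JOne jOneExpr
  linarith

end J1Chain

end CaseOne

end Summit.Ventures.PercRepro2
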